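import Summits.CriticalPhenomena.PercolationContinuityZ3.Theorems.PercNearOneGluingNoHeavyLowerTailSahiTriangleClassT
import Mathlib.Tactic.Linarith
import Mathlib.Tactic.Ring
import Mathlib.Tactic.Positivity
import HarnessLib

/-!
# `NoHeavyLowerTail` (crux stmt-CriticalPhenomena-4575), P2 — T₁ WITH AN ABSTRACT CO-SHARED BLOCK: the HUB-CORNER FORMS
# `q₀, q₁` (crossing the triply-shared coin FIRST), the cubic identity, and `T₁ ⟸ q₀ ≥ 0 ∧ q₁ ≥ 0`

Memo `FROM-prim-masterthm-p2-g30-CORNER-POLARISATION.md`, SAHI-ROUTE.md §4.57 (seat `prim-masterthm-p2`, gen 30;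
`--supports stmt-CriticalPhenomena-4575`).  No `sorry`, no named facts, standard axioms.

SETTING (Kahn's `C₃` / Sahi's `E₃ ≥ 0` for the class T₁ = "exactly one coordinate essential to all three functions", with the
co-shared block of the first two members ARBITRARY).  `z ∈ Fin 2` is the hub coin (weight `wZ`, `wZ 0 + wZ 1 = 1`), `γ` a finite
block with probability weight `wC` (in the application an FKG lattice: a cube `{0,1}^k` with a product law, a chain, …), `α, β` finite
FKG lattices (weights `wA, wB`).  The triple is `f(z,c,a), g(z,c,b), h(z,a,b)` on `α × β × (Fin 2 × γ)` with the product weight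
`wA ⊗ wB ⊗ (wZ ⊗ wC)`: `f, g` share the hub `z` AND the block `γ`, `h` sees the hub but not `γ`.  (For `γ = Fin 2` this is
T₁(|C|=1) of `…SahiHubTwoLevelI3`; for `γ` a point it is THEOREM A of `…SahiSharedTwoPoint`.)

* `exL z φ` — the LEVEL-`z` expectation (over `α × β × γ`) of a function on the whole space; `ex_split`: `E = wZ 0·E⁰ + wZ 1·E¹`.
* `levelE3 z` (`P_z`) — Sahi's `E₃` of the level-`z` triple `(f_z, g_z, h_z)` on `α × β × γ`: a CLASS-T triple (`h_z` is `γ`-free), hence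
  `≥ 0` by `SahiTriangleClassT.sahiE_three_nonneg_triangle` (`levelE3_nonneg`).
* `cornerQ1`, `cornerQ0` — the HUB-CORNER FORMS (memo §1; `E^z` = `exL z`):
  `q₁ = 2E¹(fgh)+2E⁰(fgh) − E⁰f·E¹(gh) − E¹f·E⁰(gh) − E⁰g·E¹(fh) − E¹g·E⁰(fh) − E⁰h·E¹(fg) − E¹h·E⁰(fg) − E¹fE¹gE¹h + E⁰fE¹gE¹h + E¹fE⁰gE¹h + E¹fE¹gE⁰h`,
  `q₀` = the same eight terms `− E⁰fE⁰gE⁰h + E¹fE⁰gE⁰h + E⁰fE¹gE⁰h + E⁰fE⁰gE¹h`.  They are `2E₃(1) − E₃'(1)` and `2E₃(0) + E₃'(0)`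
  for `t = wZ 1 ↦ E₃`, i.e. master-conj's mixed coefficients MC2/MC1 (the `λ = 2` rung, SAHI-ROUTE §4.36–4.37) at the hub coordinate.
* `sahiE_hub_eq` — **THE CUBIC IDENTITY** `E₃ = (wZ 0)²·P₀ + (wZ 1)²·P₁ + (wZ 0)(wZ 1)·[(wZ 0)·q₀ + (wZ 1)·q₁]` (pure bookkeeping).
* `sahiE_three_nonneg_of_corner` — `P₀, P₁, q₀, q₁ ≥ 0 ⟹ E₃ ≥ 0`; `sahiE_three_nonneg_of_bernstein` — the weaker cubic-Bernstein
  form `P₀, P₁, P₀+q₀, P₁+q₁ ≥ 0 ⟹ E₃ ≥ 0` (`E₃ = (1−t)³P₀ + t(1−t)²(P₀+q₀) + t²(1−t)(P₁+q₁) + t³P₁`).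
* `sahiE_three_nonneg_T1_of_corner` — **T₁ ⟸ Q**: for monotone nonnegative data on FKG blocks `α, β, γ`, Kahn's `C₃` holds for
  `f(z,c,a), g(z,c,b), h(z,a,b)` at every hub bias as soon as `q₀ ≥ 0` and `q₁ ≥ 0` (CONJECTURE Q of the memo: census-clean on cubes,
  chains, grids and NON-product FKG squares, 0 negatives; a certificate LP valid for general `γ` is feasible in every sampled cell, memo §4).
HONEST LABEL: reduction + frame; `C₃`, T₁ (|C| ≥ 2) OPEN. [this work]
-/

noncomputable section

open scoped Classical

namespace Summit.CriticalPhenomena.PercolationContinuityZ3.Theorems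

namespace SahiHubCorner

open Finset Literature.Combinatorics.Sahi2008

section Defs

variable {α β γ : Type} [Fintype α] [Fintype β] [Fintype γ]
  (wA : α → ℝ) (wB : β → ℝ) (wC : γ → ℝ) (wZ : Fin 2 → ℝ)
  (f : Fin 2 → γ → α → ℝ) (g : Fin 2 → γ → β → ℝ) (h : Fin 2 → α → β → ℝ)

/-- The product weight `wA ⊗ wB ⊗ (wZ ⊗ wC)` on `α × β × (Fin 2 × γ)`. [this work] -/
def W (q : α × β × (Fin 2 × γ)) : ℝ := wA q.1 * wB q.2.1 * (wZ q.2.2.1 * wC q.2.2.2)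

/-- The level weight `wA ⊗ wB ⊗ wC` on `α × β × γ`. [this work] -/
def WL (q : α × β × γ) : ℝ := wA q.1 * wB q.2.1 * wC q.2.2

/-- LEVEL-`z` EXPECTATION of a function on the whole space: `E^z φ = Σ_{a,b,c} wA wB wC · φ(a,b,(z,c))`. [this work] -/
def exL (z : Fin 2) (φ : α × β × (Fin 2 × γ) → ℝ) : ℝ :=
  ex (WL wA wB wC) (fun q : α × β × γ => φ (q.1, q.2.1, (z, q.2.2)))

/-- The first member `f(z,c,a)` as a function on the whole space. [this work] -/
def F1 (q : α × β × (Fin 2 × γ)) : ℝ := f q.2.2.1 q.2.2.2 q.1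
/-- The second member `g(z,c,b)`. [this work] -/
def F2 (q : α × β × (Fin 2 × γ)) : ℝ := g q.2.2.1 q.2.2.2 q.2.1
/-- The third member `h(z,a,b)` (blind to the block `γ`). [this work] -/
def F3 (q : α × β × (Fin 2 × γ)) : ℝ := h q.2.2.1 q.1 q.2.1

/-- `P_z` = Sahi's `E₃` of the LEVEL-`z` triple, written in level moments:
`2E^z(fgh) − E^zf·E^z(gh) − E^zg·E^z(fh) − E^zh·E^z(fg) + E^zf·E^zg·E^zh`. [this work] -/
def levelE3 (z : Fin 2) : ℝ :=
  2 * exL wA wB wC z (F1 f * F2 g * F3 h) - exL wA wB wC z (F1 f) * exL wA wB wC z (F2 g * F3 h)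
    - exL wA wB wC z (F2 g) * exL wA wB wC z (F1 f * F3 h) - exL wA wB wC z (F3 h) * exL wA wB wC z (F1 f * F2 g)
    + exL wA wB wC z (F1 f) * exL wA wB wC z (F2 g) * exL wA wB wC z (F3 h)

/-- The eight "mixed" terms common to both hub-corner forms. [this work] -/
def cornerMixed : ℝ :=
  2 * exL wA wB wC 1 (F1 f * F2 g * F3 h) + 2 * exL wA wB wC 0 (F1 f * F2 g * F3 h)
    - exL wA wB wC 0 (F1 f) * exL wA wB wC 1 (F2 g * F3 h) - exL wA wB wC 1 (F1 f) * exL wA wB wC 0 (F2 g * F3 h)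
    - exL wA wB wC 0 (F2 g) * exL wA wB wC 1 (F1 f * F3 h) - exL wA wB wC 1 (F2 g) * exL wA wB wC 0 (F1 f * F3 h)
    - exL wA wB wC 0 (F3 h) * exL wA wB wC 1 (F1 f * F2 g) - exL wA wB wC 1 (F3 h) * exL wA wB wC 0 (F1 f * F2 g)

/-- **HUB-CORNER FORM `q₁`** (corner `t = 1`; = `2E₃(1) − E₃'(1)`; master-conj's MC2 at the hub). [this work] -/
def cornerQ1 : ℝ :=
  cornerMixed wA wB wC f g h
    - exL wA wB wC 1 (F1 f) * exL wA wB wC 1 (F2 g) * exL wA wB wC 1 (F3 h)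
    + exL wA wB wC 0 (F1 f) * exL wA wB wC 1 (F2 g) * exL wA wB wC 1 (F3 h)
    + exL wA wB wC 1 (F1 f) * exL wA wB wC 0 (F2 g) * exL wA wB wC 1 (F3 h)
    + exL wA wB wC 1 (F1 f) * exL wA wB wC 1 (F2 g) * exL wA wB wC 0 (F3 h)

/-- **HUB-CORNER FORM `q₀`** (corner `t = 0`; = `2E₃(0) + E₃'(0)`; master-conj's MC1 at the hub). [this work] -/
def cornerQ0 : ℝ :=
  cornerMixed wA wB wC f g h
    - exL wA wB wC 0 (F1 f) * exL wA wB wC 0 (F2 g) * exL wA wB wC 0 (F3 h)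
    + exL wA wB wC 1 (F1 f) * exL wA wB wC 0 (F2 g) * exL wA wB wC 0 (F3 h)
    + exL wA wB wC 0 (F1 f) * exL wA wB wC 1 (F2 g) * exL wA wB wC 0 (F3 h)
    + exL wA wB wC 0 (F1 f) * exL wA wB wC 0 (F2 g) * exL wA wB wC 1 (F3 h)

end Defs

section Identity

variable {α β γ : Type} [Fintype α] [Fintype β] [Fintype γ]
  {wA : α → ℝ} {wB : β → ℝ} {wC : γ → ℝ} {wZ : Fin 2 → ℝ}
  {f : Fin 2 → γ → α → ℝ} {g : Fin 2 → γ → β → ℝ} {h : Fin 2 → α → β → ℝ}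

/-- **Level splitting**: `E_W φ = wZ 0 · E⁰φ + wZ 1 · E¹φ` for every function `φ` on the whole space. [this work] -/
theorem ex_split (φ : α × β × (Fin 2 × γ) → ℝ) :
    ex (W wA wB wC wZ) φ = wZ 0 * exL wA wB wC 0 φ + wZ 1 * exL wA wB wC 1 φ := by
  simp only [ex, exL, W, WL, Fintype.sum_prod_type, Fin.sum_univ_two, Finset.mul_sum, ← Finset.sum_add_distrib]
  refine Finset.sum_congr rfl fun a _ => Finset.sum_congr rfl fun b _ => Finset.sum_congr rfl fun c _ => ?_
  ring

/-- `P_z` IS Sahi's `E₃` of the level-`z` triple `(f_z(c,a), g_z(c,b), h_z(a,b))` on `α × β × γ` (a class-T triple). [this work] -/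
theorem levelE3_eq (z : Fin 2) :
    levelE3 wA wB wC f g h z =
      sahiE (WL wA wB wC) 3 ![fun q => f z q.2.2 q.1, fun q => g z q.2.2 q.2.1, fun q => h z q.1 q.2.1] := by
  rw [sahiE_three]
  simp only [levelE3, exL, F1, F2, F3, Pi.mul_def]
  ring

/-- **THE CUBIC IDENTITY** (memo §1): with `s = wZ 0`, `t = wZ 1` (`s + t = 1`),
`E₃(f,g,h) = s²·P₀ + t²·P₁ + s·t·(s·q₀ + t·q₁)`.  Pure bookkeeping (no sign or lattice hypothesis). [this work] -/
theorem sahiE_hub_eq (hZ : wZ 0 + wZ 1 = 1) :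
    sahiE (W wA wB wC wZ) 3 ![F1 f, F2 g, F3 h] =
      wZ 0 ^ 2 * levelE3 wA wB wC f g h 0 + wZ 1 ^ 2 * levelE3 wA wB wC f g h 1
        + wZ 0 * wZ 1 * (wZ 0 * cornerQ0 wA wB wC f g h + wZ 1 * cornerQ1 wA wB wC f g h) := by
  rw [sahiE_three]
  simp only [ex_split]
  unfold levelE3 cornerQ0 cornerQ1 cornerMixed
  have h0 : wZ 0 = 1 - wZ 1 := by linarith
  rw [h0]
  ring

/-- **CORNER CRITERION**: `P₀, P₁, q₀, q₁ ≥ 0 ⟹ E₃ ≥ 0` (at every hub bias `wZ ≥ 0`, `wZ 0 + wZ 1 = 1`). [this work] -/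
theorem sahiE_three_nonneg_of_corner (hZ0 : 0 ≤ wZ 0) (hZ1 : 0 ≤ wZ 1) (hZ : wZ 0 + wZ 1 = 1)
    (hP0 : 0 ≤ levelE3 wA wB wC f g h 0) (hP1 : 0 ≤ levelE3 wA wB wC f g h 1)
    (hq0 : 0 ≤ cornerQ0 wA wB wC f g h) (hq1 : 0 ≤ cornerQ1 wA wB wC f g h) :
    0 ≤ sahiE (W wA wB wC wZ) 3 ![F1 f, F2 g, F3 h] := by
  rw [sahiE_hub_eq hZ]
  positivity

/-- **BERNSTEIN CRITERION** (weaker hypotheses): `E₃ = s³P₀ + t s²(P₀+q₀) + t² s(P₁+q₁) + t³P₁`, so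
`P₀, P₁ ≥ 0`, `P₀ + q₀ ≥ 0`, `P₁ + q₁ ≥ 0 ⟹ E₃ ≥ 0` (master-conj's BGC at the hub). [this work] -/
theorem sahiE_three_nonneg_of_bernstein (hZ0 : 0 ≤ wZ 0) (hZ1 : 0 ≤ wZ 1) (hZ : wZ 0 + wZ 1 = 1)
    (hP0 : 0 ≤ levelE3 wA wB wC f g h 0) (hP1 : 0 ≤ levelE3 wA wB wC f g h 1)
    (hb1 : 0 ≤ levelE3 wA wB wC f g h 0 + cornerQ0 wA wB wC f g h)
    (hb2 : 0 ≤ levelE3 wA wB wC f g h 1 + cornerQ1 wA wB wC f g h) :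
    0 ≤ sahiE (W wA wB wC wZ) 3 ![F1 f, F2 g, F3 h] := by
  rw [sahiE_hub_eq hZ]
  have h0 : wZ 0 = 1 - wZ 1 := by linarith
  have e : wZ 0 ^ 2 * levelE3 wA wB wC f g h 0 + wZ 1 ^ 2 * levelE3 wA wB wC f g h 1
        + wZ 0 * wZ 1 * (wZ 0 * cornerQ0 wA wB wC f g h + wZ 1 * cornerQ1 wA wB wC f g h)
      = wZ 0 ^ 3 * levelE3 wA wB wC f g h 0 + wZ 1 * wZ 0 ^ 2 * (levelE3 wA wB wC f g h 0 + cornerQ0 wA wB wC f g h)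
        + wZ 1 ^ 2 * wZ 0 * (levelE3 wA wB wC f g h 1 + cornerQ1 wA wB wC f g h) + wZ 1 ^ 3 * levelE3 wA wB wC f g h 1 := by
    rw [h0]; ring
  rw [e]
  positivity

/-- **SYMMETRIC CLOSED FORM of `q₁`** (memo §1): with `ΔX = E¹X − E⁰X`,
`q₁ = P₁ + P₀ + Δf·[Cov¹(g,h) − E⁰(gh)] + Δg·[Cov¹(f,h) − E⁰(fh)] + Δh·[Cov¹(f,g) − E⁰(fg)] + E¹fE¹gE¹h − E⁰fE⁰gE⁰h`
(`Cov¹(g,h) = E¹(gh) − E¹gE¹h`).  Pure bookkeeping. [this work] -/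
theorem cornerQ1_eq_levels :
    cornerQ1 wA wB wC f g h = levelE3 wA wB wC f g h 1 + levelE3 wA wB wC f g h 0
      + (exL wA wB wC 1 (F1 f) - exL wA wB wC 0 (F1 f))
          * (exL wA wB wC 1 (F2 g * F3 h) - exL wA wB wC 1 (F2 g) * exL wA wB wC 1 (F3 h) - exL wA wB wC 0 (F2 g * F3 h))
      + (exL wA wB wC 1 (F2 g) - exL wA wB wC 0 (F2 g))
          * (exL wA wB wC 1 (F1 f * F3 h) - exL wA wB wC 1 (F1 f) * exL wA wB wC 1 (F3 h) - exL wA wB wC 0 (F1 f * F3 h))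
      + (exL wA wB wC 1 (F3 h) - exL wA wB wC 0 (F3 h))
          * (exL wA wB wC 1 (F1 f * F2 g) - exL wA wB wC 1 (F1 f) * exL wA wB wC 1 (F2 g) - exL wA wB wC 0 (F1 f * F2 g))
      + exL wA wB wC 1 (F1 f) * exL wA wB wC 1 (F2 g) * exL wA wB wC 1 (F3 h)
      - exL wA wB wC 0 (F1 f) * exL wA wB wC 0 (F2 g) * exL wA wB wC 0 (F3 h) := by
  unfold cornerQ1 cornerMixed levelE3; ring

/-- **SYMMETRIC CLOSED FORM of `q₀`**:
`q₀ = P₀ + P₁ + Δf·[E¹(gh) − Cov⁰(g,h)] + Δg·[E¹(fh) − Cov⁰(f,h)] + Δh·[E¹(fg) − Cov⁰(f,g)] − (E¹fE¹gE¹h − E⁰fE⁰gE⁰h)`. [this work] -/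
theorem cornerQ0_eq_levels :
    cornerQ0 wA wB wC f g h = levelE3 wA wB wC f g h 0 + levelE3 wA wB wC f g h 1
      + (exL wA wB wC 1 (F1 f) - exL wA wB wC 0 (F1 f))
          * (exL wA wB wC 1 (F2 g * F3 h) - (exL wA wB wC 0 (F2 g * F3 h) - exL wA wB wC 0 (F2 g) * exL wA wB wC 0 (F3 h)))
      + (exL wA wB wC 1 (F2 g) - exL wA wB wC 0 (F2 g))
          * (exL wA wB wC 1 (F1 f * F3 h) - (exL wA wB wC 0 (F1 f * F3 h) - exL wA wB wC 0 (F1 f) * exL wA wB wC 0 (F3 h)))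
      + (exL wA wB wC 1 (F3 h) - exL wA wB wC 0 (F3 h))
          * (exL wA wB wC 1 (F1 f * F2 g) - (exL wA wB wC 0 (F1 f * F2 g) - exL wA wB wC 0 (F1 f) * exL wA wB wC 0 (F2 g)))
      - (exL wA wB wC 1 (F1 f) * exL wA wB wC 1 (F2 g) * exL wA wB wC 1 (F3 h)
          - exL wA wB wC 0 (F1 f) * exL wA wB wC 0 (F2 g) * exL wA wB wC 0 (F3 h)) := by
  unfold cornerQ0 cornerMixed levelE3; ring

end Identity

section Reduction

variable {α β γ : Type} [Fintype α] [Fintype β] [Fintype γ]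
  {wA : α → ℝ} {wB : β → ℝ} {wC : γ → ℝ} {wZ : Fin 2 → ℝ}
  {f : Fin 2 → γ → α → ℝ} {g : Fin 2 → γ → β → ℝ} {h : Fin 2 → α → β → ℝ}

/-- **Each level is a class-T triple, hence `P_z ≥ 0`** (`SahiTriangleClassT.sahiE_three_nonneg_triangle`: FKG blocks `α, β, γ`,
monotone nonnegative sections `f_z(c,a), g_z(c,b), h_z(a,b)`). [this work] -/
theorem levelE3_nonneg [DistribLattice α] [DistribLattice β] [DistribLattice γ]
    (hA : IsFKGMeasure wA) (hB : IsFKGMeasure wB) (hC : IsFKGMeasure wC) (z : Fin 2)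
    (hf0 : ∀ c a, 0 ≤ f z c a) (hfa : ∀ c, Monotone (f z c)) (hfc : ∀ a, Monotone (fun c => f z c a))
    (hg0 : ∀ c b, 0 ≤ g z c b) (hgb : ∀ c, Monotone (g z c)) (hgc : ∀ b, Monotone (fun c => g z c b))
    (hh0 : ∀ a b, 0 ≤ h z a b) (hha : ∀ b, Monotone (fun a => h z a b)) (hhb : ∀ a, Monotone (h z a)) :
    0 ≤ levelE3 wA wB wC f g h z := by
  rw [levelE3_eq]
  exact SahiTriangleClassT.sahiE_three_nonneg_triangle hA hB hC hf0 hfa hfc hg0 hgb hgc hh0 hha hhb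

/-- **T₁ ⟸ Q (THE REDUCTION).**  For the T₁ triple `f(z,c,a), g(z,c,b), h(z,a,b)` with an ARBITRARY finite FKG co-shared block `γ`
(FKG blocks `α, β`; any hub weight `wZ ≥ 0`, `wZ 0 + wZ 1 = 1`; sections nonnegative and monotone in `c, a, b` — monotonicity in
`z` is not even needed here), Kahn's `C₃` / Sahi's `E₃ ≥ 0` holds as soon as the two hub-corner forms are nonnegative:
`q₀ ≥ 0 ∧ q₁ ≥ 0 ⟹ E₃ ≥ 0`.  (CONJECTURE Q of the memo asserts `q₀, q₁ ≥ 0` for all such data monotone in `z` as well.) [this work] -/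
theorem sahiE_three_nonneg_T1_of_corner [DistribLattice α] [DistribLattice β] [DistribLattice γ]
    (hA : IsFKGMeasure wA) (hB : IsFKGMeasure wB) (hC : IsFKGMeasure wC)
    (hZ0 : 0 ≤ wZ 0) (hZ1 : 0 ≤ wZ 1) (hZ : wZ 0 + wZ 1 = 1)
    (hf0 : ∀ z c a, 0 ≤ f z c a) (hfa : ∀ z c, Monotone (f z c)) (hfc : ∀ z a, Monotone (fun c => f z c a))
    (hg0 : ∀ z c b, 0 ≤ g z c b) (hgb : ∀ z c, Monotone (g z c)) (hgc : ∀ z b, Monotone (fun c => g z c b))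
    (hh0 : ∀ z a b, 0 ≤ h z a b) (hha : ∀ z b, Monotone (fun a => h z a b)) (hhb : ∀ z a, Monotone (h z a))
    (hq0 : 0 ≤ cornerQ0 wA wB wC f g h) (hq1 : 0 ≤ cornerQ1 wA wB wC f g h) :
    0 ≤ sahiE (W wA wB wC wZ) 3 ![F1 f, F2 g, F3 h] :=
  sahiE_three_nonneg_of_corner hZ0 hZ1 hZ
    (levelE3_nonneg hA hB hC 0 (hf0 0) (hfa 0) (hfc 0) (hg0 0) (hgb 0) (hgc 0) (hh0 0) (hha 0) (hhb 0))
    (levelE3_nonneg hA hB hC 1 (hf0 1) (hfa 1) (hfc 1) (hg0 1) (hgb 1) (hgc 1) (hh0 1) (hha 1) (hhb 1)) hq0 hq1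

/-- The same with the weaker BERNSTEIN hypotheses `P₀ + q₀ ≥ 0`, `P₁ + q₁ ≥ 0` (master-conj's BGC at the hub coordinate). [this work] -/
theorem sahiE_three_nonneg_T1_of_bernstein [DistribLattice α] [DistribLattice β] [DistribLattice γ]
    (hA : IsFKGMeasure wA) (hB : IsFKGMeasure wB) (hC : IsFKGMeasure wC)
    (hZ0 : 0 ≤ wZ 0) (hZ1 : 0 ≤ wZ 1) (hZ : wZ 0 + wZ 1 = 1)
    (hf0 : ∀ z c a, 0 ≤ f z c a) (hfa : ∀ z c, Monotone (f z c)) (hfc : ∀ z a, Monotone (fun c => f z c a))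
    (hg0 : ∀ z c b, 0 ≤ g z c b) (hgb : ∀ z c, Monotone (g z c)) (hgc : ∀ z b, Monotone (fun c => g z c b))
    (hh0 : ∀ z a b, 0 ≤ h z a b) (hha : ∀ z b, Monotone (fun a => h z a b)) (hhb : ∀ z a, Monotone (h z a))
    (hb1 : 0 ≤ levelE3 wA wB wC f g h 0 + cornerQ0 wA wB wC f g h)
    (hb2 : 0 ≤ levelE3 wA wB wC f g h 1 + cornerQ1 wA wB wC f g h) :
    0 ≤ sahiE (W wA wB wC wZ) 3 ![F1 f, F2 g, F3 h] :=
  sahiE_three_nonneg_of_bernstein hZ0 hZ1 hZ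
    (levelE3_nonneg hA hB hC 0 (hf0 0) (hfa 0) (hfc 0) (hg0 0) (hgb 0) (hgc 0) (hh0 0) (hha 0) (hhb 0))
    (levelE3_nonneg hA hB hC 1 (hf0 1) (hfa 1) (hfc 1) (hg0 1) (hgb 1) (hgc 1) (hh0 1) (hha 1) (hhb 1)) hb1 hb2

end Reduction

end SahiHubCorner

end Summit.CriticalPhenomena.PercolationContinuityZ3.Theorems
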